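import Summits.SmoothPoincare4.SmoothPoincare4.Theorems.DottedCircleRasmussenDcrGapHelperFriendsCarrierVkPartBTubeLemmas
import Summits.SmoothPoincare4.SmoothPoincare4.Theorems.DottedCircleRasmussenDcrGapHelperFriendsCarrierVkPartBFlowOut

/-!
# Helper `helper_friendsCarrier_Vk_partB_tubeBlend` (piece of the registered stub
`helper_friendsCarrier_Vk_partB`, line `mk_friends`, skeleton v8) for crux `DcrGap`
(item stmt-SmoothPoincare4-16128, route route-SmoothPoincare4-DottedCircleRasmussen)

**The blended tube of the reparametrised slice disc (half B2 of Part B of V_k, unscaled).**  Let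
`g = f₁ ∘ R` be the flow-line reparametrisation of the neat model slice disc `f₁` (`…VkPartBDisc`), which
on the band `‖x‖ ≥ 1 - τ₁` is the zero section `C(x, 0)` of the flow-out tube
`C(x, w) = Φ(1 - ‖x‖, νK(x/‖x‖, w))` (`…VkPartBFlowOut`), and let `(n₀, n₁)` be a transversal framing of
`f₁` over the closed disc whose values on the circle are the fibre derivatives of `νK` (Part A of V_k).
The tube of Part B is the blend

  `G₀(x, w) = A(x, w) + χ(‖x‖) (C(x, w) - A(x, w))`,  `A(x, w) = g x + w₀ n₀(R x) + w₁ n₁(R x)`,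

with a radial cutoff `χ` (`0` below `1 - θ/2`, `1` above `1 - θ/4 = 1 - s₁`): the affine tube on the
transported framing in the deep part, the flow-out tube over the band — the tree's `tube₀` of
`SliceDiscConicalTube.lean` with the cone replaced by the flow-out and the tubes (rather than the
framings) blended.  This file proves: `G₀` is `C^∞` on `B(0, 1 + τ₁) × ℝ²`; `G₀(x, 0) = g x`; `G₀ = C`
over `‖x‖ ≥ 1 - s₁`; and **along the zero section over the closed disc its differential
`(v, a) ↦ dgₓ v + Σ aᵢ ((1 - χ) nᵢ(R x) + χ cᵢ(x))` is invertible** (`cᵢ` the fibre derivatives of `C`):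
below the cutoff by transversality of `nᵢ` to `df₁` transported through `dR`, on the thin blending zone
because at the circle `cᵢ = nᵢ` and `R = id`, so every blend is the transversal frame `(n₀, n₁)` there,
and linear independence is open (`exists_thickening_linearIndependent`), which fixes `θ`.

No definitions, no named facts, no `sorry`.
-/

-- the prescribed namespace `Summit.<P>.<Sub>.…` duplicates `SmoothPoincare4` (P = Sub)
set_option linter.dupNamespace false
set_option linter.style.longLine false

noncomputable section

open scoped Manifold ContDiff Topology
open Set Function Metric Filter
open Literature.Topology.FourManifolds Literature.Topology.FourManifolds.MMSW

namespace Summit.SmoothPoincare4.SmoothPoincare4.Theorems.DcrGap.MkFriends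

namespace FriendsCarrierVk

set_option maxHeartbeats 1600000 in
/-- **The blended tube and its differential along the zero section.** [folklore] -/
theorem exists_blendTube {k : ℕ} {K₁ : (Metric.sphere (0 : EuclideanSpace ℝ (Fin 2)) 1) → (EuclideanSpace ℝ (Fin 4))}
    {f₁ g : (EuclideanSpace ℝ (Fin 2)) → (EuclideanSpace ℝ (Fin 4))} {Rm : (EuclideanSpace ℝ (Fin 2)) → (EuclideanSpace ℝ (Fin 2))}
    {νK : (Metric.sphere (0 : EuclideanSpace ℝ (Fin 2)) 1) × (EuclideanSpace ℝ (Fin 2)) → (EuclideanSpace ℝ (Fin 4))}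
    {Φ : ℝ × (EuclideanSpace ℝ (Fin 4)) → (EuclideanSpace ℝ (Fin 4))} {ε τ₁ : ℝ} {n₀ n₁ : (EuclideanSpace ℝ (Fin 2)) → (EuclideanSpace ℝ (Fin 4))}
    (hf : IsModelSliceDisc k K₁ f₁)
    (hν : ContMDiff ((𝓡 1).prod 𝓘(ℝ, EuclideanSpace ℝ (Fin 2))) 𝓘(ℝ, EuclideanSpace ℝ (Fin 4)) ∞ νK)
    (hν0 : ∀ u : (Metric.sphere (0 : EuclideanSpace ℝ (Fin 2)) 1), νK (u, 0) = K₁ u)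
    (hΦs : ContDiff ℝ ∞ Φ) (h0 : ∀ x, Φ (0, x) = x) (hε : 0 < ε)
    (hg : IsModelSliceDisc k K₁ g) (hτ₁ : 0 < τ₁) (hτ₁1 : τ₁ ≤ 1 / 4)
    (hgR : ∀ x : EuclideanSpace ℝ (Fin 2), ‖x‖ < 1 + τ₁ → g x = f₁ (Rm x))
    (hRs : ∀ x : EuclideanSpace ℝ (Fin 2), ‖x‖ < 1 + τ₁ → ContDiffAt ℝ ∞ Rm x)
    (hRimm : ∀ x : EuclideanSpace ℝ (Fin 2), ‖x‖ < 1 + τ₁ → Injective (fderiv ℝ Rm x))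
    (hRle : ∀ x : EuclideanSpace ℝ (Fin 2), ‖x‖ ≤ 1 → ‖Rm x‖ ≤ 1) (hRcirc : ∀ x : EuclideanSpace ℝ (Fin 2), ‖x‖ = 1 → Rm x = x)
    (hgout : ∀ x : EuclideanSpace ℝ (Fin 2), 1 - τ₁ ≤ ‖x‖ → g x = Φ (1 - ‖x‖, f₁ (unitVec x)))
    (hn₀ : ContDiff ℝ ∞ n₀) (hn₁ : ContDiff ℝ ∞ n₁)
    (htrans : ∀ x ∈ closedBall (0 : EuclideanSpace ℝ (Fin 2)) 1, ∀ (v : EuclideanSpace ℝ (Fin 2)) (a b : ℝ),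
      fderiv ℝ f₁ x v + a • n₀ x + b • n₁ x = 0 → v = 0 ∧ a = 0 ∧ b = 0)
    (hbdry : ∀ u : (Metric.sphere (0 : EuclideanSpace ℝ (Fin 2)) 1),
      n₀ u = fderiv ℝ (fun w : EuclideanSpace ℝ (Fin 2) => νK (u, w)) 0 (EuclideanSpace.single 0 1) ∧
      n₁ u = fderiv ℝ (fun w : EuclideanSpace ℝ (Fin 2) => νK (u, w)) 0 (EuclideanSpace.single 1 1)) :
    ∃ (s₁ : ℝ) (G₀ : (EuclideanSpace ℝ (Fin 2)) × (EuclideanSpace ℝ (Fin 2)) → EuclideanSpace ℝ (Fin 4)),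
      0 < s₁ ∧ s₁ < τ₁ ∧ s₁ < 2 * ε ∧
      ContDiffOn ℝ ∞ G₀ (ball (0 : EuclideanSpace ℝ (Fin 2)) (1 + τ₁) ×ˢ (univ : Set (EuclideanSpace ℝ (Fin 2)))) ∧
      (∀ x : EuclideanSpace ℝ (Fin 2), G₀ (x, 0) = g x) ∧
      (∀ x w : EuclideanSpace ℝ (Fin 2), 1 - s₁ ≤ ‖x‖ → G₀ (x, w) = Φ (1 - ‖x‖, νK (radialProjection (spherePt 1) x, w))) ∧
      (∀ x ∈ closedBall (0 : EuclideanSpace ℝ (Fin 2)) 1,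
        ∃ e : ((EuclideanSpace ℝ (Fin 2)) × (EuclideanSpace ℝ (Fin 2))) ≃L[ℝ] EuclideanSpace ℝ (Fin 4), HasFDerivAt G₀ (e : _ →L[ℝ] _) (x, 0)) := by
  have hfs : ContDiff ℝ ∞ f₁ := contMDiff_iff_contDiff.1 hf.1
  have hgs : ContDiff ℝ ∞ g := contMDiff_iff_contDiff.1 hg.1
  -- A. the flow-out tube and its fibre derivatives
  set C : (EuclideanSpace ℝ (Fin 2)) × (EuclideanSpace ℝ (Fin 2)) → EuclideanSpace ℝ (Fin 4) :=
    fun q => Φ (1 - ‖q.1‖, νK (radialProjection (spherePt 1) q.1, q.2)) with hCdef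
  set cv : Fin 2 → (EuclideanSpace ℝ (Fin 2)) → EuclideanSpace ℝ (Fin 4) :=
    fun i x => fderiv ℝ C (x, 0) (0, EuclideanSpace.single i 1) with hcvdef
  have hCs : ∀ q : (EuclideanSpace ℝ (Fin 2)) × (EuclideanSpace ℝ (Fin 2)), q.1 ≠ 0 → ContDiffAt ℝ ∞ C q :=
    fun q hq => contDiffAt_flowOut hν hΦs hq
  have hC0 : ∀ x : EuclideanSpace ℝ (Fin 2), 1 - τ₁ ≤ ‖x‖ → C (x, 0) = g x := fun x hx => by
    rw [hgout x hx]; exact flowOut_fst_zero hf hν0 x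
  -- the fibre derivative of `C` at circle points is the prescribed framing
  have hcv_coe : ∀ (i : Fin 2) (u : (Metric.sphere (0 : EuclideanSpace ℝ (Fin 2)) 1)),
      cv i u = fderiv ℝ (fun w : EuclideanSpace ℝ (Fin 2) => νK (u, w)) 0 (EuclideanSpace.single i 1) := by
    intro i u
    have hu0 : (u : EuclideanSpace ℝ (Fin 2)) ≠ 0 := by
      intro h; have := norm_eq_of_mem_sphere u; rw [h, norm_zero] at this; exact zero_ne_one this
    have hdiff : DifferentiableAt ℝ C ((u : EuclideanSpace ℝ (Fin 2)), 0) := (hCs _ hu0).differentiableAt (by simp)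
    simp only [hcvdef]
    rw [← fderiv_comp_prodMk_right C hdiff, ← fderiv_flowOut_fibre_coe (νK := νK) h0 u]
  have hn_coe : ∀ (i : Fin 2) (u : (Metric.sphere (0 : EuclideanSpace ℝ (Fin 2)) 1)), ![n₀, n₁] i u = cv i u := by
    intro i u
    rw [hcv_coe i u]
    fin_cases i
    · exact (hbdry u).1
    · exact (hbdry u).2
  -- B. the family of frames and its independence near the circle
  set Fam : (EuclideanSpace ℝ (Fin 2)) × ℝ → Fin 4 → EuclideanSpace ℝ (Fin 4) := fun p =>
    ![fderiv ℝ g p.1 (EuclideanSpace.single 0 1), fderiv ℝ g p.1 (EuclideanSpace.single 1 1),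
      (1 - p.2) • n₀ (Rm p.1) + p.2 • cv 0 p.1, (1 - p.2) • n₁ (Rm p.1) + p.2 • cv 1 p.1] with hFam
  set U : Set ((EuclideanSpace ℝ (Fin 2)) × ℝ) := {p | p.1 ≠ 0 ∧ ‖p.1‖ < 1 + τ₁} with hU
  have hUo : IsOpen U := (isOpen_ne_fun continuous_fst continuous_const).inter
    (isOpen_lt (continuous_norm.comp continuous_fst) continuous_const)
  have hcvc : ∀ i, ContinuousOn (fun x : EuclideanSpace ℝ (Fin 2) => cv i x) {x | x ≠ 0} := by
    intro i
    have hO : IsOpen {q : (EuclideanSpace ℝ (Fin 2)) × (EuclideanSpace ℝ (Fin 2)) | q.1 ≠ 0} := isOpen_ne_fun continuous_fst continuous_const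
    have hCon : ContDiffOn ℝ ∞ C {q : (EuclideanSpace ℝ (Fin 2)) × (EuclideanSpace ℝ (Fin 2)) | q.1 ≠ 0} := fun q hq => (hCs q hq).contDiffWithinAt
    have hfd : ContinuousOn (fderiv ℝ C) {q : (EuclideanSpace ℝ (Fin 2)) × (EuclideanSpace ℝ (Fin 2)) | q.1 ≠ 0} :=
      hCon.continuousOn_fderiv_of_isOpen hO (by simp)
    have h1 : ContinuousOn (fun x : EuclideanSpace ℝ (Fin 2) => fderiv ℝ C (x, 0)) {x | x ≠ 0} :=
      hfd.comp (continuous_id.prodMk continuous_const).continuousOn fun x hx => hx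
    exact h1.clm_apply continuousOn_const
  have hFamc : ContinuousOn Fam U := by
    have hd : Continuous (fderiv ℝ g) := hgs.continuous_fderiv (by simp)
    have hRc : ContinuousOn Rm {x : EuclideanSpace ℝ (Fin 2) | ‖x‖ < 1 + τ₁} := fun x hx => (hRs x hx).continuousAt.continuousWithinAt
    have hnR : ∀ n : (EuclideanSpace ℝ (Fin 2)) → EuclideanSpace ℝ (Fin 4), ContDiff ℝ ∞ n →
        ContinuousOn (fun p : (EuclideanSpace ℝ (Fin 2)) × ℝ => n (Rm p.1)) U := fun n hn =>
      (hn.continuous.comp_continuousOn hRc).comp continuous_fst.continuousOn fun p hp => hp.2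
    have hcvU : ∀ i, ContinuousOn (fun p : (EuclideanSpace ℝ (Fin 2)) × ℝ => cv i p.1) U := fun i =>
      (hcvc i).comp continuous_fst.continuousOn fun p hp => hp.1
    have hblend : ∀ (i : Fin 2) (n : (EuclideanSpace ℝ (Fin 2)) → EuclideanSpace ℝ (Fin 4)), ContDiff ℝ ∞ n →
        ContinuousOn (fun p : (EuclideanSpace ℝ (Fin 2)) × ℝ => (1 - p.2) • n (Rm p.1) + p.2 • cv i p.1) U := fun i n hn =>
      ((continuous_const.sub continuous_snd).continuousOn.smul (hnR n hn)).add (continuous_snd.continuousOn.smul (hcvU i))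
    refine continuousOn_pi.2 fun j => ?_
    fin_cases j
    · exact ((hd.comp continuous_fst).clm_apply continuous_const).continuousOn
    · exact ((hd.comp continuous_fst).clm_apply continuous_const).continuousOn
    · exact hblend 0 n₀ hn₀
    · exact hblend 1 n₁ hn₁
  set S : Set ((EuclideanSpace ℝ (Fin 2)) × ℝ) := (Metric.sphere (0 : EuclideanSpace ℝ (Fin 2)) 1) ×ˢ Icc (0 : ℝ) 1 with hS
  have hSc : IsCompact S := (isCompact_sphere _ _).prod isCompact_Icc
  have hSU : S ⊆ U := by
    rintro ⟨x, l⟩ ⟨hx, -⟩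
    have hx1 : ‖x‖ = 1 := by simpa using hx
    have hx0 : x ≠ 0 := by intro h; rw [h, norm_zero] at hx1; exact zero_ne_one hx1
    exact ⟨hx0, by show ‖x‖ < 1 + τ₁; rw [hx1]; linarith⟩
  -- transversality of the transported framing below the band
  have hg_fr : ∀ x : EuclideanSpace ℝ (Fin 2), ‖x‖ < 1 + τ₁ →
      fderiv ℝ g x = (fderiv ℝ f₁ (Rm x)).comp (fderiv ℝ Rm x) := by
    intro x hx
    have hev : g =ᶠ[𝓝 x] fun y => f₁ (Rm y) := by
      filter_upwards [(isOpen_lt continuous_norm continuous_const).mem_nhds hx] with y hy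
      exact hgR y hy
    rw [hev.fderiv_eq]
    have hRd : HasFDerivAt Rm (fderiv ℝ Rm x) x := ((hRs x hx).differentiableAt (by simp)).hasFDerivAt
    have hfd : HasFDerivAt f₁ (fderiv ℝ f₁ (Rm x)) (Rm x) := ((hfs.differentiable (by simp)) _).hasFDerivAt
    exact (hfd.comp x hRd).fderiv
  have htransR : ∀ x : EuclideanSpace ℝ (Fin 2), ‖x‖ ≤ 1 → ∀ (v : EuclideanSpace ℝ (Fin 2)) (a b : ℝ),
      fderiv ℝ g x v + a • n₀ (Rm x) + b • n₁ (Rm x) = 0 → v = 0 ∧ a = 0 ∧ b = 0 := by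
    intro x hx
    rw [hg_fr x (by linarith)]
    exact transversal_comp (hRimm x (by linarith)) (htrans (Rm x) (mem_closedBall_zero_iff.2 (hRle x hx)))
  have hSind : ∀ p ∈ S, LinearIndependent ℝ (Fam p) := by
    rintro ⟨x, l⟩ ⟨hx, -⟩
    have hx1 : ‖x‖ = 1 := by simpa using hx
    set u : (Metric.sphere (0 : EuclideanSpace ℝ (Fin 2)) 1) := ⟨x, hx⟩ with hu
    have hcv0 : cv 0 x = n₀ x := by have := hn_coe 0 u; simpa [hu] using this.symm
    have hcv1 : cv 1 x = n₁ x := by have := hn_coe 1 u; simpa [hu] using this.symm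
    have h3 : (1 - l) • n₀ (Rm x) + l • cv 0 x = n₀ (Rm x) := by rw [hcv0, hRcirc x hx1]; module
    have h4 : (1 - l) • n₁ (Rm x) + l • cv 1 x = n₁ (Rm x) := by rw [hcv1, hRcirc x hx1]; module
    have key := transversal_iff_linearIndependent.1 (htransR x hx1.le)
    simp only [hFam, h3, h4]
    exact key
  obtain ⟨δ₁, hδ₁, hthick⟩ := exists_thickening_linearIndependent hUo hFamc hSc hSU hSind
  have hnear : ∀ (x : EuclideanSpace ℝ (Fin 2)) (l : ℝ), x ≠ 0 → |‖x‖ - 1| < δ₁ → l ∈ Icc (0 : ℝ) 1 → LinearIndependent ℝ (Fam (x, l)) := by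
    intro x l hx0 hx hl
    refine (hthick (x, l) (mem_thickening_iff.2 ?_)).2
    refine ⟨(unitVec x, l), ⟨by simp [norm_unitVec hx0], hl⟩, ?_⟩
    rw [Prod.dist_eq, dist_self, max_eq_left dist_nonneg, dist_eq_norm]
    have : x - unitVec x = (‖x‖ - 1) • unitVec x := by
      rw [sub_smul, one_smul, norm_smul_unitVec]
    rw [this, norm_smul, norm_unitVec hx0, mul_one, Real.norm_eq_abs]
    exact hx
  -- C. the radii and the cutoff
  set θ : ℝ := min τ₁ (min δ₁ ε) with hθ
  have hθpos : 0 < θ := lt_min hτ₁ (lt_min hδ₁ hε)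
  have hθτ : θ ≤ τ₁ := min_le_left _ _
  have hθδ : θ ≤ δ₁ := (min_le_right _ _).trans (min_le_left _ _)
  have hθε : θ ≤ ε := (min_le_right _ _).trans (min_le_right _ _)
  set a₁ : ℝ := 1 - θ / 2 with ha₁
  set a₂ : ℝ := 1 - θ / 4 with ha₂
  have ha₁pos : 0 < a₁ := by rw [ha₁]; linarith [hθτ.trans hτ₁1]
  have ha₁₂ : a₁ < a₂ := by rw [ha₁, ha₂]; linarith
  set χ : (EuclideanSpace ℝ (Fin 2)) → ℝ := radialCut a₁ a₂ with hχ
  have hχs : ContDiff ℝ ∞ χ := contDiff_radialCut ha₁pos ha₁₂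
  have hχ0 : ∀ x : EuclideanSpace ℝ (Fin 2), ‖x‖ ≤ a₁ → χ x = 0 := fun x hx => radialCut_of_le ha₁₂ hx
  have hχ1 : ∀ x : EuclideanSpace ℝ (Fin 2), a₂ ≤ ‖x‖ → χ x = 1 := fun x hx => radialCut_of_ge ha₁₂ hx
  have hχ01 : ∀ x : EuclideanSpace ℝ (Fin 2), χ x ∈ Icc (0 : ℝ) 1 := fun x => radialCut_mem x
  -- D. the blended tube
  set A : (EuclideanSpace ℝ (Fin 2)) × (EuclideanSpace ℝ (Fin 2)) → EuclideanSpace ℝ (Fin 4) :=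
    fun q => g q.1 + q.2 0 • n₀ (Rm q.1) + q.2 1 • n₁ (Rm q.1) with hAdef
  set G₀ : (EuclideanSpace ℝ (Fin 2)) × (EuclideanSpace ℝ (Fin 2)) → EuclideanSpace ℝ (Fin 4) :=
    fun q => A q + χ q.1 • (C q - A q) with hG₀
  have hA0 : ∀ x, A (x, 0) = g x := fun x => by simp [hAdef]
  have hCA0 : ∀ x : EuclideanSpace ℝ (Fin 2), a₁ < ‖x‖ → C (x, 0) = A (x, 0) := fun x hx => by
    rw [hA0, hC0 x (by rw [ha₁] at hx; linarith)]
  have hG₀zero : ∀ x, G₀ (x, 0) = g x := by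
    intro x
    by_cases hx : ‖x‖ ≤ a₁
    · simp only [hG₀, hχ0 x hx, zero_smul, add_zero, hA0]
    · simp only [hG₀, hCA0 x (lt_of_not_ge hx), sub_self, smul_zero, add_zero, hA0]
  have hG₀band : ∀ x w : EuclideanSpace ℝ (Fin 2), a₂ ≤ ‖x‖ → G₀ (x, w) = C (x, w) := by
    intro x w hx
    simp only [hG₀, hχ1 x hx, one_smul, add_sub_cancel]
  -- smoothness of the pieces
  have hAs : ∀ q : (EuclideanSpace ℝ (Fin 2)) × (EuclideanSpace ℝ (Fin 2)), ‖q.1‖ < 1 + τ₁ → ContDiffAt ℝ ∞ A q := by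
    intro q hq
    have hR := hRs q.1 hq
    have hc : ∀ i : Fin 2, ContDiffAt ℝ ∞ (fun q : (EuclideanSpace ℝ (Fin 2)) × (EuclideanSpace ℝ (Fin 2)) => q.2 i) q :=
      fun i => (show ContDiff ℝ ∞ (fun q : (EuclideanSpace ℝ (Fin 2)) × (EuclideanSpace ℝ (Fin 2)) => q.2 i) by fun_prop).contDiffAt
    simp only [hAdef]
    exact ((hgs.contDiffAt.comp q contDiffAt_fst).add ((hc 0).smul ((hn₀.contDiffAt.comp _ hR).comp q contDiffAt_fst))).add
      ((hc 1).smul ((hn₁.contDiffAt.comp _ hR).comp q contDiffAt_fst))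
  have hG₀s : ContDiffOn ℝ ∞ G₀ (ball (0 : EuclideanSpace ℝ (Fin 2)) (1 + τ₁) ×ˢ (univ : Set (EuclideanSpace ℝ (Fin 2)))) := by
    rintro q ⟨hq, -⟩
    rw [mem_ball_zero_iff] at hq
    refine ContDiffAt.contDiffWithinAt ?_
    by_cases h1 : ‖q.1‖ < a₁
    · have hev : G₀ =ᶠ[𝓝 q] A := by
        have ho : IsOpen {p : (EuclideanSpace ℝ (Fin 2)) × (EuclideanSpace ℝ (Fin 2)) | ‖p.1‖ < a₁} :=
          isOpen_lt (continuous_norm.comp continuous_fst) continuous_const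
        filter_upwards [ho.mem_nhds (show ‖q.1‖ < a₁ from h1)] with p hp
        simp only [hG₀, hχ0 p.1 (le_of_lt hp), zero_smul, add_zero]
      exact (hAs q hq).congr_of_eventuallyEq hev
    · have hq0 : q.1 ≠ 0 := by
        intro h; rw [h, norm_zero] at h1; exact h1 ha₁pos
      have hχq : ContDiffAt ℝ ∞ (fun p : (EuclideanSpace ℝ (Fin 2)) × (EuclideanSpace ℝ (Fin 2)) => χ p.1) q :=
        hχs.contDiffAt.comp q contDiffAt_fst
      simp only [hG₀]
      exact (hAs q hq).add (hχq.smul ((hCs q hq0).sub (hAs q hq)))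
  -- E. the differential along the zero section
  have hderiv : ∀ x : EuclideanSpace ℝ (Fin 2), ‖x‖ ≤ 1 →
      ∃ e : ((EuclideanSpace ℝ (Fin 2)) × (EuclideanSpace ℝ (Fin 2))) ≃L[ℝ] EuclideanSpace ℝ (Fin 4), HasFDerivAt G₀ (e : _ →L[ℝ] _) (x, 0) := by
    intro x hx
    have hx' : ‖x‖ < 1 + τ₁ := by linarith
    -- the blended frame at `x`
    set m₀ : EuclideanSpace ℝ (Fin 4) := (1 - χ x) • n₀ (Rm x) + χ x • cv 0 x with hm₀
    set m₁ : EuclideanSpace ℝ (Fin 4) := (1 - χ x) • n₁ (Rm x) + χ x • cv 1 x with hm₁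
    -- it is transversal to `dg`
    have htr : ∀ (v : EuclideanSpace ℝ (Fin 2)) (a b : ℝ), fderiv ℝ g x v + a • m₀ + b • m₁ = 0 → v = 0 ∧ a = 0 ∧ b = 0 := by
      by_cases h1 : ‖x‖ ≤ a₁
      · have : χ x = 0 := hχ0 x h1
        simp only [hm₀, hm₁, this, sub_zero, one_smul, zero_smul, add_zero]
        exact htransR x hx
      · push Not at h1
        have hxa : |‖x‖ - 1| < δ₁ := by
          rw [abs_lt]; rw [ha₁] at h1; constructor <;> linarith
        have hx0 : x ≠ 0 := by intro h; rw [h, norm_zero] at h1; linarith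
        have hind := hnear x (χ x) hx0 hxa (hχ01 x)
        rw [transversal_iff_linearIndependent]
        simpa only [hFam, hm₀, hm₁] using hind
    obtain ⟨e, he⟩ := exists_equiv_of_transversal htr
    refine ⟨e, ?_⟩
    rw [he]
    -- the affine part
    have hRd : DifferentiableAt ℝ Rm x := (hRs x hx').differentiableAt (by simp)
    have hA' : HasFDerivAt A _ (x, 0) := hasFDerivAt_affineTube ((hgs.differentiable (by simp)) x)
      ((hn₀.differentiable (by simp)).differentiableAt.comp x hRd) ((hn₁.differentiable (by simp)).differentiableAt.comp x hRd)
    by_cases h1 : ‖x‖ < a₁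
    · -- near `x` the tube is the affine tube, and `χ x = 0`
      have hev : G₀ =ᶠ[𝓝 (x, 0)] A := by
        have ho : IsOpen {p : (EuclideanSpace ℝ (Fin 2)) × (EuclideanSpace ℝ (Fin 2)) | ‖p.1‖ < a₁} :=
          isOpen_lt (continuous_norm.comp continuous_fst) continuous_const
        filter_upwards [ho.mem_nhds (show ‖((x, (0 : EuclideanSpace ℝ (Fin 2))) : (EuclideanSpace ℝ (Fin 2)) × (EuclideanSpace ℝ (Fin 2))).1‖ < a₁ from h1)] with p hp
        simp only [hG₀, hχ0 p.1 (le_of_lt hp), zero_smul, add_zero]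
      have hχx : χ x = 0 := hχ0 x h1.le
      have hm₀' : m₀ = n₀ (Rm x) := by simp only [hm₀, hχx, sub_zero, one_smul, zero_smul, add_zero]
      have hm₁' : m₁ = n₁ (Rm x) := by simp only [hm₁, hχx, sub_zero, one_smul, zero_smul, add_zero]
      rw [hm₀', hm₁']
      exact hA'.congr_of_eventuallyEq hev
    · -- the blending zone and the band: product rule, with `C - A = 0` on the zero section
      push Not at h1
      have hx0 : x ≠ 0 := by intro h; rw [h, norm_zero] at h1; linarith
      have hband1 : 1 - τ₁ < ‖x‖ := by rw [ha₁] at h1; linarith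
      have hCd : HasFDerivAt C (fderiv ℝ C (x, 0)) (x, 0) := ((hCs (x, 0) hx0).differentiableAt (by simp)).hasFDerivAt
      have hχd : HasFDerivAt (fun q : (EuclideanSpace ℝ (Fin 2)) × (EuclideanSpace ℝ (Fin 2)) => χ q.1)
          (fderiv ℝ (fun q : (EuclideanSpace ℝ (Fin 2)) × (EuclideanSpace ℝ (Fin 2)) => χ q.1) (x, 0)) (x, 0) :=
        ((hχs.contDiffAt.comp (x, 0) contDiffAt_fst).differentiableAt (by simp)).hasFDerivAt
      have hCA : C (x, 0) = A (x, 0) := by rw [hA0, hC0 x hband1.le]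
      have hbl := hasFDerivAt_blend hA' hCd hχd hCA
      refine hbl.congr_fderiv ?_
      -- identification of the two linear maps
      have hCfst : fderiv ℝ (fun x' => C (x', 0)) x = fderiv ℝ g x := by
        have hev : (fun x' => C (x', 0)) =ᶠ[𝓝 x] g := by
          filter_upwards [(isOpen_lt continuous_const continuous_norm).mem_nhds hband1] with y hy
          exact hC0 y hy.le
        exact hev.fderiv_eq
      have hCdiff : DifferentiableAt ℝ C (x, 0) := hCd.differentiableAt
      have hCva : ∀ (v a : EuclideanSpace ℝ (Fin 2)), fderiv ℝ C (x, 0) (v, a) = fderiv ℝ g x v + (a 0 • cv 0 x + a 1 • cv 1 x) := by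
        intro v a
        rw [fderiv_apply_prod_eq hCdiff, hCfst, fderiv_fibre_decomp x 0 a]
        simp only [hcvdef, fderiv_comp_prodMk_right C hCdiff]
      refine ContinuousLinearMap.ext fun q => ?_
      obtain ⟨v, a⟩ := q
      simp [hCva, hm₀, hm₁]
      module
  refine ⟨θ / 4, G₀, by positivity, by linarith, by linarith, hG₀s, hG₀zero, fun x w hx => hG₀band x w (by rw [ha₂]; linarith),
    fun x hx => hderiv x (mem_closedBall_zero_iff.1 hx)⟩

end FriendsCarrierVk

open FriendsCarrierVk in
/-- **Helper `helper_friendsCarrier_Vk_partB_tubeBlend`** (piece of the registered stub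
`helper_friendsCarrier_Vk_partB`: the blended tube of the reparametrised slice disc, unscaled).  The blend
`G₀ = A + χ(‖x‖)(C - A)` of the affine tube `A(x, w) = g x + Σ wᵢ nᵢ(R x)` on the transported framing
with the flow-out tube `C(x, w) = Φ(1 - ‖x‖, νK(x/‖x‖, w))` is `C^∞` on `B(0, 1 + τ₁) × ℝ²`, restricts to
`g` on the zero section, equals `C` over `‖x‖ ≥ 1 - s₁`, and has invertible differential along the zero
section over the closed disc. [cite: Kosinski1993, Ch. III Thm (4.2)] -/
theorem helper_friendsCarrier_Vk_partB_tubeBlend : ∀ (k : ℕ) (K₁ : (Metric.sphere (0 : EuclideanSpace ℝ (Fin 2)) 1) → (EuclideanSpace ℝ (Fin 4))) (f₁ g : (EuclideanSpace ℝ (Fin 2)) → (EuclideanSpace ℝ (Fin 4))) (Rm : (EuclideanSpace ℝ (Fin 2)) → (EuclideanSpace ℝ (Fin 2))) (νK : (Metric.sphere (0 : EuclideanSpace ℝ (Fin 2)) 1) × (EuclideanSpace ℝ (Fin 2)) → (EuclideanSpace ℝ (Fin 4))) (Φ : ℝ × (EuclideanSpace ℝ (Fin 4)) → (EuclideanSpace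 ℝ (Fin 4))) (ε τ₁ : ℝ) (n₀ n₁ : (EuclideanSpace ℝ (Fin 2)) → (EuclideanSpace ℝ (Fin 4))), IsModelSliceDisc k K₁ f₁ → ContMDiff ((𝓡 1).prod 𝓘(ℝ, EuclideanSpace ℝ (Fin 2))) 𝓘(ℝ, EuclideanSpace ℝ (Fin 4)) ((⊤ : ℕ∞) : WithTop ℕ∞) νK → (∀ u : (Metric.sphere (0 : EuclideanSpace ℝ (Fin 2)) 1), νK (u, 0) = K₁ u) → ContDiff ℝ ((⊤ : ℕ∞) : WithTop ℕ∞) Φ → (∀ x, Φ (0, x) = x) → 0 < ε → IsModelSliceDisc k K₁ g → 0 < τ₁ → τ₁ ≤ 1 / 4 → (∀ x : (EuclideanSpace ℝ (Fin 2)), ‖x‖ < 1 + τ₁ → g x = f₁ (Rm x)) → (∀ x : (EuclideanSpace ℝ (Fin 2)), ‖x‖ < 1 + τ₁ → ContDiffAt ℝ ((⊤ : ℕ∞) : WithTop ℕ∞) Rm x) → (∀ x : (EuclideanSpace ℝ (Fin 2)), ‖x‖ < 1 + τ₁ → Function.Injective (fderiv ℝ Rm x)) → (∀ x : (EuclideanSpace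 ℝ (Fin 2)), ‖x‖ ≤ 1 → ‖Rm x‖ ≤ 1) → (∀ x : (EuclideanSpace ℝ (Fin 2)), ‖x‖ = 1 → Rm x = x) → (∀ x : (EuclideanSpace ℝ (Fin 2)), 1 - τ₁ ≤ ‖x‖ → g x = Φ (1 - ‖x‖, f₁ (unitVec x))) → ContDiff ℝ ((⊤ : ℕ∞) : WithTop ℕ∞) n₀ → ContDiff ℝ ((⊤ : ℕ∞) : WithTop ℕ∞) n₁ → (∀ x ∈ Metric.closedBall (0 : (EuclideanSpace ℝ (Fin 2))) 1, ∀ (v : (EuclideanSpace ℝ (Fin 2))) (a b : ℝ), fderiv ℝ f₁ x v + a • n₀ x + b • n₁ x = 0 → v = 0 ∧ a = 0 ∧ b = 0) → (∀ u : (Metric.sphere (0 : EuclideanSpace ℝ (Fin 2)) 1), n₀ u = fderiv ℝ (fun w : (EuclideanSpace ℝ (Fin 2)) => νK (u, w)) 0 (EuclideanSpace.single 0 1) ∧ n₁ u = fderiv ℝ (fun w : (EuclideanSpace ℝ (Fin 2)) => νK (u, w)) 0 (EuclideanSpace.single 1 1)) → ∃ (s₁ : ℝ) (G₀ : (EuclideanSpace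 ℝ (Fin 2)) × (EuclideanSpace ℝ (Fin 2)) → (EuclideanSpace ℝ (Fin 4))), 0 < s₁ ∧ s₁ < τ₁ ∧ s₁ < 2 * ε ∧ ContDiffOn ℝ ((⊤ : ℕ∞) : WithTop ℕ∞) G₀ (Metric.ball (0 : (EuclideanSpace ℝ (Fin 2))) (1 + τ₁) ×ˢ (Set.univ : Set (EuclideanSpace ℝ (Fin 2)))) ∧ (∀ x : (EuclideanSpace ℝ (Fin 2)), G₀ (x, 0) = g x) ∧ (∀ x w : (EuclideanSpace ℝ (Fin 2)), 1 - s₁ ≤ ‖x‖ → G₀ (x, w) = Φ (1 - ‖x‖, νK (radialProjection (spherePt 1) x, w))) ∧ (∀ x ∈ Metric.closedBall (0 : (EuclideanSpace ℝ (Fin 2))) 1, ∃ e : ((EuclideanSpace ℝ (Fin 2)) × (EuclideanSpace ℝ (Fin 2))) ≃L[ℝ] (EuclideanSpace ℝ (Fin 4)), HasFDerivAt G₀ (e : ((EuclideanSpace ℝ (Fin 2)) × (EuclideanSpace ℝ (Fin 2))) →L[ℝ] (EuclideanSpace ℝ (Fin 4))) (x, 0)) :=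
  fun _ _ _ _ _ _ _ _ _ _ _ hf hν hν0 hΦs h0 hε hg hτ₁ hτ₁1 hgR hRs hRimm hRle hRcirc hgout hn₀ hn₁ htrans hbdry =>
    exists_blendTube hf hν hν0 hΦs h0 hε hg hτ₁ hτ₁1 hgR hRs hRimm hRle hRcirc hgout hn₀ hn₁ htrans hbdry

end Summit.SmoothPoincare4.SmoothPoincare4.Theorems.DcrGap.MkFriends

end
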